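import Mathlib
import Summits.KontsevichZagierPeriods.Zeta5Search.BrickLucasAssembly
import Summits.KontsevichZagierPeriods.Zeta5Search.BrickHoleWeightSharp

/-!
# BrickStripConstLocal — CROSS-ROW LOCALITY of the strip constant of a ° cell one digit beyond its valuation:
`λ_k/E_k(0) ≡ λ⁰_{k₀}/E⁰_{k₀}(0) (mod p^{m+1})` (cell zeta5-irr)

HONEST FRAMING: systematic search; no irrationality claim unless certified. INSTRUMENT-tier arithmetic of the ζ(5)
census cell zeta5-irr (HOME `run/shared/lean/pub/zeta5-irr/`), filed by the engine seat zi-eng (g13). WHAT THIS IS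
NOT: nothing about ζ(5); no denominator saving; 0 nats/n; rung F-Z1 NOT moved. Plumbing for the strip-sum law (V) of
`BrickLucasAssembly.lucas_of_blockLaws` (the carry digits with exactly one paid member).

## The statement (`stripConst_local`)

`p` odd, row `n = n₀ + Np`, ° digit `k₀ ≤ n₀ < p` off the centre (`2k₀ ≠ n₀`), block `K ≤ N`, kernel `ε ≤ 1`; the strip
constant `a_k := λ_k/E_k(0)` (`λ_k = c_{k,A}(n)/c̃_{K,A}(N)`, `E_k = carryPoly`, `E_k(0) ≠ 0` off the centre) has
`v(a_k) = exp(−m)`, `m = B c_a + B c_b` (`BrickLambdaCirc.padicValuation_stripConst`); here: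
**`v(a_k − a⁰_{k₀}) ≤ exp(−(m+1))`**, where `a⁰_{k₀}` is the strip constant of the same digit in the one-digit row `n₀`
(block `0` of the row `n₀ + 0·p`).

PROOF: by the closed form `λ·U = σ·(n/2−k)^ε·Y` (`BrickLambdaClosedForm.lambda_mul_unitPart`, unit factorials) and
`E_k(0) = (−y_a)^{Bc_a} y_b^{Bc_b}` (`BrickLambdaCirc.carryPoly_eval_zero`), `a_k = σ·(n/2−k)^ε·p^m·Ŷ/((−1)^{Bc_a}U)`
(`stripConst_closed`) with `Ŷ = n!_p^A (n+k)!_p^B (2n−k)!_p^B`; the Gauss–Wilson block law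
`(x₀ + Xp)!_p ≡ (−1)^X x₀!_p (mod p)` (`GaussWilsonBlock.unitFactorial_shift_iter`) gives `Ŷ·U⁰ ≡ Ŷ⁰·U (mod p)` (the
signs `(−1)^X` cancel between `Ŷ` and `U`), the signs `σ, σ⁰` agree (`p + 1` even) and `(n/2 − k) ≡ (n₀/2 − k₀) (mod p)`.
-/

namespace Summit.KontsevichZagierPeriods.Zeta5Search.BrickStripConstLocal

open Finset Nat WithZero
open Summit.KontsevichZagierPeriods.Zeta5Search.BrickTopCoefficient (cTop)
open Summit.KontsevichZagierPeriods.Zeta5Search.BrickDigitStripCirc (carryPoly centreCarry)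
open Summit.KontsevichZagierPeriods.Zeta5Search.BrickLambda (cTop_zero_ne_zero padicValuation_two)
open Summit.KontsevichZagierPeriods.Zeta5Search.BrickLambdaCirc (carryPoly_eval_zero)
open Summit.KontsevichZagierPeriods.Zeta5Search.GaussWilsonBlock (unitFactorial unitFactorial_shift_iter)
open Summit.KontsevichZagierPeriods.Zeta5Search.BrickLambdaClosedForm (unitPart gainPart padicValuation_unitPart
  lambda_mul_unitPart padicValuation_unitFactorial)
open Summit.KontsevichZagierPeriods.Zeta5Search.BrickLambdaLocality (padicValuation_sub_le_of_zmod_eq)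
open Summit.KontsevichZagierPeriods.Zeta5Search.BrickHoleWeightSharp (padicValuation_half_sub_le)
open Literature.NumberTheory.LFunctions (padicValuation_natCast_le_one)

noncomputable section

variable {p : ℕ} [Fact p.Prime]

/-- The Gauss–Wilson block law mod `p` in the form `(x₀ + X·p)!_p ≡ (−1)^X·x₀!_p`. -/
theorem uf_shift (hp2 : p ≠ 2) (x₀ X : ℕ) :
    ((unitFactorial p (x₀ + X * p) : ℕ) : ZMod (p ^ 1)) = (-1) ^ X * ((unitFactorial p x₀ : ℕ) : ZMod (p ^ 1)) := by
  have hp : p.Prime := Fact.out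
  have h3 : 3 ≤ p := by have := hp.two_le; omega
  rw [show x₀ + X * p = x₀ + p ^ 1 * X by ring]
  exact unitFactorial_shift_iter p 1 x₀ X hp h3 le_rfl

omit [Fact p.Prime] in
/-- The gained part split into its reduced part `Ŷ = n!_p^A·(n+k)!_p^B·(2n−k)!_p^B` and the paid members (digits
`n₀ = k₀ + m₀`, `N = K + M`). -/
theorem gainPart_eq (p A B k₀ m₀ K M : ℕ) :
    gainPart p A B k₀ m₀ K M =
      (unitFactorial p (k₀ + m₀ + (K + M) * p) ^ A * unitFactorial p (k₀ + m₀ + (K + M) * p + (k₀ + K * p)) ^ B *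
          unitFactorial p (m₀ + M * p + (k₀ + m₀ + (K + M) * p)) ^ B) *
        ((p * (K + M + K + 1)) ^ ((k₀ + m₀ + k₀) / p) * (p * (K + M + M + 1)) ^ ((k₀ + m₀ + m₀) / p)) ^ B := by
  unfold gainPart; ring

omit [Fact p.Prime] in
/-- A non-centre digit has no centre carry in any block (`2k₀ ≠ n₀`, `k₀ ≤ n₀ < p`). -/
theorem centreCarry_eq_zero {n₀ k₀ : ℕ} (hn₀ : n₀ < p) (hk₀ : k₀ ≤ n₀) (hc : 2 * k₀ ≠ n₀) (N' K' : ℕ) :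
    centreCarry p (n₀ + N' * p) (k₀ + K' * p) = 0 := by
  unfold centreCarry
  rw [if_neg]
  intro h
  have h' : (p : ℤ) ∣ (n₀ : ℤ) - 2 * k₀ := by
    have e : ((n₀ + N' * p : ℕ) : ℤ) - 2 * ((k₀ + K' * p : ℕ) : ℤ) = ((n₀ : ℤ) - 2 * k₀) + p * ((N' : ℤ) - 2 * K') := by
      push_cast; ring
    rw [e] at h
    exact (dvd_add_left (dvd_mul_right _ _)).1 h
  have hz : (n₀ : ℤ) - 2 * k₀ = 0 := by
    refine Int.eq_zero_of_dvd_of_natAbs_lt_natAbs h' ?_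
    rw [Int.natAbs_natCast]; omega
  omega

section local_

variable (hp2 : p ≠ 2) {A B ε k₀ m₀ : ℕ} (hε : ε ≤ 1) (hn₀ : k₀ + m₀ < p) (hc : 2 * k₀ ≠ k₀ + m₀)
include hp2 hε hn₀ hc

omit hp2 hε in
/-- **THE STRIP CONSTANT IN CLOSED FORM** (digits `n₀ = k₀ + m₀`, `N = K + M`, non-centre digit):
`λ_k/E_k(0) = σ·(n/2 − k)^ε·p^m·Ŷ/((−1)^{B c_a}·U)` with the unit part `U`, the reduced gained part `Ŷ`,
`σ = (−1)^{nB+kA}(−1)^{NB+KA}`, `m = B c_a + B c_b`. -/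
theorem stripConst_closed (K M : ℕ) :
    cTop A B ε (k₀ + m₀ + (K + M) * p) (k₀ + K * p) / cTop A B 0 (K + M) K /
        (carryPoly p B ε (K + M) (k₀ + m₀) K k₀).eval 0 =
      (-1) ^ ((k₀ + m₀ + (K + M) * p) * B + (k₀ + K * p) * A) * (-1) ^ ((K + M) * B + K * A) *
        (((k₀ + m₀ + (K + M) * p : ℕ) : ℚ) / 2 - ((k₀ + K * p : ℕ) : ℚ)) ^ ε *
        (p : ℚ) ^ (B * ((k₀ + m₀ + k₀) / p) + B * ((k₀ + m₀ + m₀) / p)) *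
        ((unitFactorial p (k₀ + m₀ + (K + M) * p) ^ A * unitFactorial p (k₀ + m₀ + (K + M) * p + (k₀ + K * p)) ^ B *
          unitFactorial p (m₀ + M * p + (k₀ + m₀ + (K + M) * p)) ^ B : ℕ) : ℚ) /
        ((-1) ^ (B * ((k₀ + m₀ + k₀) / p)) * (unitPart p A B k₀ m₀ K M : ℚ)) := by
  have hp : p.Prime := Fact.out
  have hKN : K ≤ K + M := Nat.le_add_right _ _
  set ca : ℕ := (k₀ + m₀ + k₀) / p with hca
  set cb : ℕ := (k₀ + m₀ + m₀) / p with hcb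
  set lam : ℚ := cTop A B ε (k₀ + m₀ + (K + M) * p) (k₀ + K * p) / cTop A B 0 (K + M) K with hlam
  set U : ℚ := (unitPart p A B k₀ m₀ K M : ℚ) with hU
  have hU0 : U ≠ 0 := fun h => by
    have := padicValuation_unitPart (p := p) A B k₀ m₀ K M; rw [← hU, h, map_zero] at this; exact zero_ne_one this
  have hs0 : ((-1 : ℚ)) ^ (B * ca) ≠ 0 := pow_ne_zero _ (by norm_num)
  have hlamU := lambda_mul_unitPart (p := p) (A := A) (B := B) (ε := ε) (J := K) (M := M) hn₀ (lam := lam)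
    (div_mul_cancel₀ _ (cTop_zero_ne_zero hKN A B))
  have hE := carryPoly_eval_zero (p := p) (B := B) (ε := ε) (n₀ := k₀ + m₀) (j₀ := k₀) hKN
  rw [centreCarry_eq_zero hn₀ (Nat.le_add_right k₀ m₀) hc, mul_zero, pow_zero, mul_one, Nat.add_sub_cancel_left,
    ← hca, ← hcb] at hE
  have hya : ((K + M + K + 1 : ℕ) : ℚ) ≠ 0 := by positivity
  have hyb : ((2 * (K + M) - K + 1 : ℕ) : ℚ) ≠ 0 := by positivity
  have hE0 : (carryPoly p B ε (K + M) (k₀ + m₀) K k₀).eval 0 ≠ 0 := by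
    rw [hE]; exact mul_ne_zero (pow_ne_zero _ (neg_ne_zero.2 hya)) (pow_ne_zero _ hyb)
  have hY : (gainPart p A B k₀ m₀ K M : ℚ) =
      ((unitFactorial p (k₀ + m₀ + (K + M) * p) ^ A * unitFactorial p (k₀ + m₀ + (K + M) * p + (k₀ + K * p)) ^ B *
          unitFactorial p (m₀ + M * p + (k₀ + m₀ + (K + M) * p)) ^ B : ℕ) : ℚ) *
        (((p : ℚ) * ((K + M + K + 1 : ℕ) : ℚ)) ^ ca * ((p : ℚ) * ((2 * (K + M) - K + 1 : ℕ) : ℚ)) ^ cb) ^ B := by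
    rw [gainPart_eq, show 2 * (K + M) - K + 1 = K + M + M + 1 by omega]
    push_cast; ring
  rw [div_eq_div_iff hE0 (mul_ne_zero hs0 hU0), show lam * ((-1 : ℚ) ^ (B * ca) * U) = lam * U * (-1) ^ (B * ca) by
    ring, hlamU, hY, hE, neg_pow]
  ring

omit [Fact p.Prime] hp2 hε hn₀ hc in
/-- The centre offsets of the block `(K, M)` and of the one-digit row differ by `p·(M − K)/2`. -/
theorem centre_sub_eq (K M : ℕ) :
    (((k₀ + m₀ + (K + M) * p : ℕ) : ℚ) / 2 - ((k₀ + K * p : ℕ) : ℚ)) - (((k₀ + m₀ : ℕ) : ℚ) / 2 - (k₀ : ℚ)) =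
      (p : ℚ) * ((((M : ℤ) - K : ℤ) : ℚ) / 2) := by
  push_cast; ring

omit hε hn₀ hc in
/-- **`Ŷ·U⁰ ≡ Ŷ⁰·U (mod p)`**: the reduced gained part and the unit part of the block `(K, M)` against those of the
one-digit row (Gauss–Wilson blocks; the signs cancel). -/
theorem reduced_cross_zmod (K M : ℕ) :
    (((unitFactorial p (k₀ + m₀ + (K + M) * p) ^ A * unitFactorial p (k₀ + m₀ + (K + M) * p + (k₀ + K * p)) ^ B *
        unitFactorial p (m₀ + M * p + (k₀ + m₀ + (K + M) * p)) ^ B) * unitPart p A B k₀ m₀ 0 0 : ℕ) : ZMod (p ^ 1)) =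
      (((unitFactorial p (k₀ + m₀ + (0 + 0) * p) ^ A * unitFactorial p (k₀ + m₀ + (0 + 0) * p + (k₀ + 0 * p)) ^ B *
        unitFactorial p (m₀ + 0 * p + (k₀ + m₀ + (0 + 0) * p)) ^ B) * unitPart p A B k₀ m₀ K M : ℕ) : ZMod (p ^ 1)) := by
  unfold unitPart
  have e1 : k₀ + m₀ + (K + M) * p + (k₀ + K * p) = (k₀ + m₀ + k₀) + (K + M + K) * p := by ring
  have e2 : m₀ + M * p + (k₀ + m₀ + (K + M) * p) = (m₀ + (k₀ + m₀)) + (M + (K + M)) * p := by ring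
  rw [e1, e2]
  simp only [zero_mul, add_zero]
  push_cast
  simp only [uf_shift hp2]
  ring

/-- **CROSS-ROW LOCALITY OF THE STRIP CONSTANT** (odd `p`, `ε ≤ 1`, ° digit off the centre, digits `n₀ = k₀ + m₀`,
any block `(K, M)`): `v(λ_k/E_k(0) − λ⁰_{k₀}/E⁰_{k₀}(0)) ≤ exp(−(m+1))`, `m = B c_a + B c_b`, the second term being the
strip constant of the block `(0,0)` (the one-digit row). -/
theorem stripConst_local (K M : ℕ) :
    Rat.padicValuation p (cTop A B ε (k₀ + m₀ + (K + M) * p) (k₀ + K * p) / cTop A B 0 (K + M) K /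
        (carryPoly p B ε (K + M) (k₀ + m₀) K k₀).eval 0 -
      cTop A B ε (k₀ + m₀ + (0 + 0) * p) (k₀ + 0 * p) / cTop A B 0 (0 + 0) 0 /
        (carryPoly p B ε (0 + 0) (k₀ + m₀) 0 k₀).eval 0) ≤
      exp (-((B * ((k₀ + m₀ + k₀) / p) + B * ((k₀ + m₀ + m₀) / p) : ℕ) : ℤ) - 1) := by
  have hp : p.Prime := Fact.out
  have hpv : Rat.padicValuation p (p : ℚ) = exp (-1 : ℤ) := Rat.padicValuation_self p
  set ca : ℕ := (k₀ + m₀ + k₀) / p with hca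
  set cb : ℕ := (k₀ + m₀ + m₀) / p with hcb
  rw [stripConst_closed (A := A) (B := B) (ε := ε) hn₀ hc K M, stripConst_closed (A := A) (B := B) (ε := ε) hn₀ hc 0 0]
  -- names
  set U : ℚ := (unitPart p A B k₀ m₀ K M : ℚ) with hU
  set U₀ : ℚ := (unitPart p A B k₀ m₀ 0 0 : ℚ) with hU₀
  set Yh : ℚ := ((unitFactorial p (k₀ + m₀ + (K + M) * p) ^ A *
      unitFactorial p (k₀ + m₀ + (K + M) * p + (k₀ + K * p)) ^ B *
      unitFactorial p (m₀ + M * p + (k₀ + m₀ + (K + M) * p)) ^ B : ℕ) : ℚ) with hYh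
  set Yh₀ : ℚ := ((unitFactorial p (k₀ + m₀ + (0 + 0) * p) ^ A *
      unitFactorial p (k₀ + m₀ + (0 + 0) * p + (k₀ + 0 * p)) ^ B *
      unitFactorial p (m₀ + 0 * p + (k₀ + m₀ + (0 + 0) * p)) ^ B : ℕ) : ℚ) with hYh₀
  set c : ℚ := ((k₀ + m₀ + (K + M) * p : ℕ) : ℚ) / 2 - ((k₀ + K * p : ℕ) : ℚ) with hcdef
  set c₀ : ℚ := ((k₀ + m₀ + (0 + 0) * p : ℕ) : ℚ) / 2 - ((k₀ + 0 * p : ℕ) : ℚ) with hc₀def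
  set s : ℚ := (-1 : ℚ) ^ (B * ca) with hs
  -- units and signs
  have hU1 : Rat.padicValuation p U = 1 := padicValuation_unitPart (p := p) A B k₀ m₀ K M
  have hU₀1 : Rat.padicValuation p U₀ = 1 := padicValuation_unitPart (p := p) A B k₀ m₀ 0 0
  have hU0 : U ≠ 0 := fun h => by rw [h, map_zero] at hU1; exact zero_ne_one hU1
  have hU₀0 : U₀ ≠ 0 := fun h => by rw [h, map_zero] at hU₀1; exact zero_ne_one hU₀1
  have hs1 : Rat.padicValuation p s = 1 := by rw [hs, map_pow, Valuation.map_neg, map_one, one_pow]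
  have hs0 : s ≠ 0 := pow_ne_zero _ (by norm_num)
  have hYh1 : Rat.padicValuation p Yh ≤ 1 := by rw [hYh]; exact padicValuation_natCast_le_one _
  have hYh₀1 : Rat.padicValuation p Yh₀ ≤ 1 := by rw [hYh₀]; exact padicValuation_natCast_le_one _
  -- the two sign prefactors agree: the exponents differ by `(p+1)·((K+M)B + KA)`, and `p + 1` is even
  obtain ⟨h2, hh2⟩ : ∃ h, p + 1 = 2 * h := ⟨(p + 1) / 2, by have := hp.eq_one_or_self_of_dvd 2; omega⟩
  have hσ : ((-1 : ℚ)) ^ ((k₀ + m₀ + (K + M) * p) * B + (k₀ + K * p) * A) * (-1) ^ ((K + M) * B + K * A) =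
      (-1) ^ ((k₀ + m₀ + (0 + 0) * p) * B + (k₀ + 0 * p) * A) * (-1) ^ ((0 + 0) * B + 0 * A) := by
    rw [← pow_add, ← pow_add, show (k₀ + m₀ + (K + M) * p) * B + (k₀ + K * p) * A + ((K + M) * B + K * A) =
      ((k₀ + m₀ + (0 + 0) * p) * B + (k₀ + 0 * p) * A + ((0 + 0) * B + 0 * A)) + 2 * (h2 * ((K + M) * B + K * A)) by
        have : (K + M) * p * B + K * p * A + ((K + M) * B + K * A) = (p + 1) * ((K + M) * B + K * A) := by ring
        rw [hh2] at this
        linear_combination this, pow_add _ _ (2 * _), pow_mul, neg_one_sq, one_pow, mul_one]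
  -- the centre offsets agree mod `p`
  have hc1 : Rat.padicValuation p c ≤ 1 := padicValuation_half_sub_le hp2 _ _
  have hcc : Rat.padicValuation p (c ^ ε - c₀ ^ ε) ≤ exp (-1 : ℤ) := by
    rcases Nat.le_one_iff_eq_zero_or_eq_one.1 hε with h | h <;> subst h
    · rw [pow_zero, pow_zero, sub_self, map_zero]; exact _root_.zero_le
    · rw [pow_one, pow_one, hcdef, hc₀def, show (0 + 0) * p = (0 + 0) * p from rfl]
      have e : (((k₀ + m₀ + (K + M) * p : ℕ) : ℚ) / 2 - ((k₀ + K * p : ℕ) : ℚ)) -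
          (((k₀ + m₀ + (0 + 0) * p : ℕ) : ℚ) / 2 - ((k₀ + 0 * p : ℕ) : ℚ)) = (p : ℚ) * ((((M : ℤ) - K : ℤ) : ℚ) / 2) := by
        push_cast; ring
      rw [e, map_mul, hpv, map_div₀, padicValuation_two hp2, div_one, Rat.padicValuation_cast]
      calc _ ≤ exp (-1 : ℤ) * 1 := mul_le_mul' le_rfl (Int.padicValuation_le_one _ _)
        _ = _ := mul_one _
  -- the reduced parts agree mod `p` (Gauss–Wilson)
  have hcross : Rat.padicValuation p (Yh * U₀ - Yh₀ * U) ≤ exp (-1 : ℤ) := by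
    have h := padicValuation_sub_le_of_zmod_eq (p := p) (k := 1) (reduced_cross_zmod (A := A) (B := B) (k₀ := k₀) (m₀ := m₀) hp2 K M)
    rw [hYh, hU₀, hYh₀, hU]
    push_cast at h ⊢
    exact h
  -- assemble
  rw [hσ, show ∀ (σ P : ℚ), σ * c ^ ε * P * Yh / (s * U) - σ * c₀ ^ ε * P * Yh₀ / (s * U₀) =
      σ / s / (U * U₀) * (P * (c ^ ε * (Yh * U₀ - Yh₀ * U) + (c ^ ε - c₀ ^ ε) * (Yh₀ * U))) from fun σ P => by
        field_simp; ring]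
  have hunit : Rat.padicValuation p ((-1 : ℚ) ^ ((k₀ + m₀ + (0 + 0) * p) * B + (k₀ + 0 * p) * A) *
      (-1) ^ ((0 + 0) * B + 0 * A) / s / (U * U₀)) = 1 := by
    rw [map_div₀, map_div₀, map_mul, map_mul, hU1, hU₀1, hs1, map_pow, map_pow, Valuation.map_neg, map_one, one_pow,
      one_pow]
    simp
  have hbr : Rat.padicValuation p (c ^ ε * (Yh * U₀ - Yh₀ * U) + (c ^ ε - c₀ ^ ε) * (Yh₀ * U)) ≤ exp (-1 : ℤ) := by
    refine (Valuation.map_add _ _ _).trans (max_le ?_ ?_)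
    · rw [map_mul]
      calc _ ≤ 1 * exp (-1 : ℤ) := mul_le_mul' (by rw [map_pow]; exact pow_le_one' hc1 _) hcross
        _ = _ := one_mul _
    · rw [map_mul, map_mul]
      calc _ ≤ exp (-1 : ℤ) * (1 * 1) := mul_le_mul' hcc (mul_le_mul' hYh₀1 hU1.le)
        _ = _ := by rw [mul_one, mul_one]
  rw [map_mul, hunit, one_mul, map_mul, map_pow, hpv, ← exp_nsmul, nsmul_eq_mul, mul_neg_one,
    show (-((B * ca + B * cb : ℕ) : ℤ) - 1) = -((B * ca + B * cb : ℕ) : ℤ) + -1 by ring, exp_add]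
  exact mul_le_mul' le_rfl hbr

end local_

end

end Summit.KontsevichZagierPeriods.Zeta5Search.BrickStripConstLocal
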